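import Literature.Geometry.Riemannian.ParabolicReGraphNormalPart
import Literature.Geometry.Riemannian.FlowC2AlphaNormLSC
import HarnessLib

/-!
# Single-sheetedness of a graph over a nearby plane (chord argument)

Topic `Literature/Geometry/Riemannian`.  Let `G x = L x + u (x, t)` be a graph over the isometric
frame `L` with `u ⊥ range L`, and let `L'` be another isometric frame with complementary
projection `Q = 1 - L' L'†`.  If along the segment `[x₁, x₂]` the tangent planes of the graph are
`δ`-close to `range L'` in the sense `‖Q ∘ (L + D u)‖ ≤ δ` with `δ < 1`, and the two graph points
have the same projection to `range L'` (`L'† (G x₁) = L'† (G x₂)`), then `x₁ = x₂`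
(`eq_of_adjoint_graph_eq`): the chord `G x₂ - G x₁` is normal to `range L'`, hence of length
`≤ δ ‖x₂ - x₁‖` by the mean value inequality, but also of length `≥ ‖x₂ - x₁‖` since
`u ⊥ range L`.  This is why the blow-up sequence in the proof of White's Thm. 3.1 (2005, p. 1499)
is a SINGLE graph over the limit plane once its tangent planes are close to it.

Everything is PROVED; no definitions, no named facts.

## References

* B. White, *A local regularity theorem for mean curvature flow*, Ann. of Math. 161 (2005), §2.5,
  p. 1499. [White2005]
-/

noncomputable section

open scoped Topology InnerProductSpace NNReal
open Filter

namespace Literature.Geometry.Riemannian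

open Literature.Analysis.PDE Literature.Analysis.PDE.Parabolic Metric Set

namespace ParabolicFlow

variable {N m : ℕ}

/-- A vector with vanishing `L'†`-component is its own normal part. [folklore] -/
theorem eq_normalPart_of_adjoint_eq_zero
    (L' : EuclideanSpace ℝ (Fin m) →ₗᵢ[ℝ] EuclideanSpace ℝ (Fin N)) {v : EuclideanSpace ℝ (Fin N)}
    (hv : L'.toContinuousLinearMap.adjoint v = 0) :
    v = v - L' (L'.toContinuousLinearMap.adjoint v) := by
  rw [hv, map_zero, sub_zero]

/-- **Chord argument / single sheet.**  Along a segment where the tangent planes of the graph of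
`u ⊥ range L` are `δ`-close to `range L'` (`δ < 1`), two graph points with the same
`L'†`-projection coincide. [cite: White2005, §2.5, p. 1499] -/
theorem eq_of_adjoint_graph_eq (L L' : EuclideanSpace ℝ (Fin m) →ₗᵢ[ℝ] EuclideanSpace ℝ (Fin N))
    {u : Parabolic (EuclideanSpace ℝ (Fin m)) → EuclideanSpace ℝ (Fin N)}
    {W : Set (Parabolic (EuclideanSpace ℝ (Fin m)))} (hu : IsC21On u W)
    (horth : ∀ X η, ⟪u X, L η⟫_ℝ = 0) {t : ℝ} {x₁ x₂ : EuclideanSpace ℝ (Fin m)}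
    (hseg : ∀ x ∈ segment ℝ x₁ x₂, (⟨x, t⟩ : Parabolic _) ∈ W) {δ : ℝ} (hδ : δ < 1)
    (hclose : ∀ x ∈ segment ℝ x₁ x₂,
      ‖(ContinuousLinearMap.id ℝ (EuclideanSpace ℝ (Fin N)) -
          L'.toContinuousLinearMap.comp L'.toContinuousLinearMap.adjoint).comp
        (L.toContinuousLinearMap + spaceDeriv u ⟨x, t⟩)‖ ≤ δ)
    (hproj : L'.toContinuousLinearMap.adjoint (L x₁ + u ⟨x₁, t⟩) =
      L'.toContinuousLinearMap.adjoint (L x₂ + u ⟨x₂, t⟩)) :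
    x₁ = x₂ := by
  -- the normal parts `f x = Q (G x)` along the segment: `‖f x₂ - f x₁‖ ≤ δ ‖x₂ - x₁‖`
  have hmv : ‖((L x₂ + u ⟨x₂, t⟩) - L' (L'.toContinuousLinearMap.adjoint (L x₂ + u ⟨x₂, t⟩))) -
      ((L x₁ + u ⟨x₁, t⟩) - L' (L'.toContinuousLinearMap.adjoint (L x₁ + u ⟨x₁, t⟩)))‖ ≤
      δ * ‖x₂ - x₁‖ :=
    (convex_segment x₁ x₂).norm_image_sub_le_of_norm_hasFDerivWithin_le
      (fun x hx => (hasFDerivAt_space_f L L' hu (hseg x hx)).hasFDerivWithinAt) hclose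
      (left_mem_segment ℝ x₁ x₂) (right_mem_segment ℝ x₁ x₂)
  -- the chord is normal to `range L'`, so it equals the difference of the normal parts
  set v := (L x₂ + u ⟨x₂, t⟩) - (L x₁ + u ⟨x₁, t⟩) with hv
  have hvadj : L'.toContinuousLinearMap.adjoint v = 0 := by
    rw [hv, map_sub, hproj, sub_self]
  have hchord : ((L x₂ + u ⟨x₂, t⟩) - L' (L'.toContinuousLinearMap.adjoint (L x₂ + u ⟨x₂, t⟩))) -
      ((L x₁ + u ⟨x₁, t⟩) - L' (L'.toContinuousLinearMap.adjoint (L x₁ + u ⟨x₁, t⟩))) = v := by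
    have h1 : ((L x₂ + u ⟨x₂, t⟩) - L' (L'.toContinuousLinearMap.adjoint (L x₂ + u ⟨x₂, t⟩))) -
        ((L x₁ + u ⟨x₁, t⟩) - L' (L'.toContinuousLinearMap.adjoint (L x₁ + u ⟨x₁, t⟩))) =
        v - L' (L'.toContinuousLinearMap.adjoint v) := by
      simp only [hv, map_sub]
      abel
    rw [h1, ← eq_normalPart_of_adjoint_eq_zero L' hvadj]
  rw [hchord] at hmv
  -- but `‖v‖ ≥ ‖x₂ - x₁‖` since `u ⊥ range L`
  have hlow : ‖x₂ - x₁‖ ≤ ‖v‖ := by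
    have hw : ∀ η, ⟪u ⟨x₂, t⟩ - u ⟨x₁, t⟩, L η⟫_ℝ = 0 := fun η => by
      rw [inner_sub_left, horth, horth, sub_zero]
    have h := norm_le_norm_map_add_of_inner_eq_zero hw (x₂ - x₁)
    have hv' : v = L (x₂ - x₁) + (u ⟨x₂, t⟩ - u ⟨x₁, t⟩) := by
      simp only [hv, map_sub]
      abel
    rwa [hv']
  have h : ‖x₂ - x₁‖ ≤ δ * ‖x₂ - x₁‖ := hlow.trans hmv
  have h0 : ‖x₂ - x₁‖ = 0 := by
    nlinarith [norm_nonneg (x₂ - x₁)]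
  rw [norm_eq_zero, sub_eq_zero] at h0
  exact h0.symm

end ParabolicFlow

end Literature.Geometry.Riemannian
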